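import Mathlib
import HarnessLib
import Summits.HubbardSuperconductivity.HubbardSuperconductivity.Theorems.KLProgrammeBareVertexPlainCurrency
import Summits.HubbardSuperconductivity.HubbardSuperconductivity.Theorems.KLProgrammePlainRowsUVCutBridge
import Summits.HubbardSuperconductivity.HubbardSuperconductivity.Theorems.KLProgrammeKLRegimeSplitConsts

/-!
# Route `KLProgramme` — ENGINE (stmt-HubbardSuperconductivity-20437 `KLRegimeEngineV17F2`), located #25 «(b)-PLAIN-UV-TAIL», cure (α): THE PLAIN POSITION-SPACE
# QUARTIC KERNEL AND PINNED CURRENCY OF THE UV-CUT BARE VERTEX `S_ĝ V` — exact identities (cell gate-hubbard-kl, seat hubbard-kl-k3c2-p2 g34; companion of ✓ p765343)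

✓ p765343 (`…BareVertexPlainCurrency`) proved `ε³Σ_{x′: x′_q = y}‖W₄(V)(x′)‖ = (|U|/24)·Θ_M` with `Θ_M = (2M)⁻³Σ_t|S_time(t)|` the normalised `L¹` mass of the
ALLOWED-quadruple trigonometric sum — `M`-divergent ([float] `≍ 0.58·(log₂M)²`), which is located #25.  Cure (α) (pen (R669)/(R670); LINKS 1–5 ✓ in tree, 18 files of
this seat + 3 of g33) re-keys the plain rows of binders #2/#5/#6 to the leg-rescaled element `S_ĝ T := ExteriorAlgebra.map (LinearMap.mulLeft ℂ ĝ) T`,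
`ĝ((k,σ),c) = gnScaleCutoff 4 klE0 1 |ω_k|`.  This file is the tree-level companion identity for the CUT vertex:
* `klbv_positionKernel_hubbardInteraction_freqMul_eq`, `klbv_plainCurrency_hubbardInteraction_freqMul_eq` — p765343's two identities with an arbitrary FREQUENCY
  multiplier `c(k₀)` on every leg (the weights `∏ c(n_i)` join the time sum; `c ≡ 1` is p765343);
* `klbv_sectorisedKernel_uvCut_hubbardInteraction_eq` — the plain kernels of `S_ĝ V` ARE the `ĝ`-weighted kernels of `V` (bridge ✓ p765436);
* **`klbv_plainCurrency_uvCut_hubbardInteraction_eq`** — `ε³Σ_{x′: x′_q = y}‖W₄(S_ĝ V)(x′)‖ = (|U|/24)·Θ^cut_M(β)`, `Θ^cut_M(β) = (2M)⁻³Σ_{t : t_q = y₀}|Σ_{n allowed}(∏ĝ(ω_{n_i}))∏e^{∓iω_{n_i}t_i}|`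
  EXACTLY; [float] kit j340333 / j340345 (HOME/hubbard-kl-k3c2-p2/g34/CUT-CURRENCY-DIGITS.md): `Θ^cut_M(β) ≈ 2.72`, FLAT in `M` once `M ≳ β/16` (regime: `M ≥ klEngM₃ ≫ β`),
  against `Θ_M = 16.98 … 61.89` (M = 16 … 512) uncut.
Pure algebra on tree definitions; no estimate, no definition; nothing asserts any row, (b), (C), K3, U₀, the window or superconductivity.
References: BGM 2006 §2.1 (2.5)–(2.6a), §2.3 (2.17), §2.5 (2.48) [cite: BenfattoGiulianiMastropietro2006]; Salmhofer 1999 §4.2.4 [cite: Salmhofer1999].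
-/

noncomputable section

namespace Summit.HubbardSuperconductivity.HubbardSuperconductivity.Theorems.KLRegimeSplit

set_option linter.dupNamespace false -- summit = problem name (single-conjunct summit), D-0017

open Finset Literature.MathematicalPhysics.QuantumLattice Literature.Probability.LatticeModels GrassmannAlgebra
open scoped ComplexConjugate

variable {L M : ℕ} [NeZero L]

/-! ## §1 The position kernel of `V` read with a frequency multiplier -/

/-- **The position-space quartic kernel of the bare vertex READ WITH A FREQUENCY MULTIPLIER** `F_ω(k) = c(k₀)` on every leg (twin of
`klbv_positionKernel_hubbardInteraction_eq`, which is the case `c ≡ 1`): at the vertex pattern `(↑+, ↑−, ↓+, ↓−)`,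
`W₄^c(V)(x) = (U(βL²)⁻³·(4!)⁻¹) · S^c_time(x) · (L⁶·𝟙[x⃗₀ = x⃗₃ ∧ x⃗₁ = x⃗₃ ∧ x⃗₂ = x⃗₃])`, `S^c_time(x) = Σ_{n : n₀+n₂ = n₁+n₃ (in ℤ)} (∏_i c(n_i)) ∏_i e^{−i s_i ω_{n_i} t_{x_i}}`. -/
theorem klbv_positionKernel_hubbardInteraction_freqMul_eq (β U : ℝ) (c : MatsubaraIdx M → ℂ) (x : Fin 4 → SpaceTimeIdx L M) :
    sectorisedKernel L M β (fun (_ : Fin 1) (k : FreqMomentum L M) => c k.1) (hubbardInteraction L M β U) 4 (![(((0 : Fin 1), (0 : Fin 2)), (0 : Fin 2)), ((0, 0), 1), ((0, 1), 0), ((0, 1), 1)] : Fin 4 → SectorLeg 1) x =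
      ((((U / (β * (L : ℝ) ^ 2) ^ 3 : ℝ)) : ℂ) * (((4 : ℕ).factorial : ℚ)⁻¹ • (1 : ℂ))) *
        ((∑ n : Fin 4 → MatsubaraIdx M,
            if matsubaraInt M (n 0) + matsubaraInt M (n 2) = matsubaraInt M (n 1) + matsubaraInt M (n 3) then
              (∏ i : Fin 4, c (n i)) * ∏ i : Fin 4, Complex.exp (-((chargeSign ((![(((0 : Fin 1), (0 : Fin 2)), (0 : Fin 2)), ((0, 0), 1), ((0, 1), 0), ((0, 1), 1)] : Fin 4 → SectorLeg 1) i).2 * (matsubaraFreq β M (n i) * imagTime β M (x i).1) : ℝ) : ℂ) * Complex.I)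
            else 0) *
          (if (x 0).2 = (x 3).2 ∧ (x 1).2 = (x 3).2 ∧ (x 2).2 = (x 3).2 then ((L : ℂ) ^ 6) else 0)) := by
  rw [sectorisedKernel_def]
  -- the multiplier is `1`; the kernel at the vertex pattern
  have hterm : ∀ k : Fin 4 → FreqMomentum L M,
      (∏ i, (fun (_ : Fin 1) (k : FreqMomentum L M) => c k.1) ((![(((0 : Fin 1), (0 : Fin 2)), (0 : Fin 2)), ((0, 0), 1), ((0, 1), 0), ((0, 1), 1)] : Fin 4 → SectorLeg 1) i).1.1 (k i) * hubbardPlaneWave L M β ((![(((0 : Fin 1), (0 : Fin 2)), (0 : Fin 2)), ((0, 0), 1), ((0, 1), 0), ((0, 1), 1)] : Fin 4 → SectorLeg 1) i).2 (k i) (x i)) *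
          kernel ℂ (hubbardInteraction L M β U) 4 (fun i => ((k i, ((![(((0 : Fin 1), (0 : Fin 2)), (0 : Fin 2)), ((0, 0), 1), ((0, 1), 0), ((0, 1), 1)] : Fin 4 → SectorLeg 1) i).1.2), ((![(((0 : Fin 1), (0 : Fin 2)), (0 : Fin 2)), ((0, 0), 1), ((0, 1), 0), ((0, 1), 1)] : Fin 4 → SectorLeg 1) i).2)) =
        ((((U / (β * (L : ℝ) ^ 2) ^ 3 : ℝ)) : ℂ) * (((4 : ℕ).factorial : ℚ)⁻¹ • (1 : ℂ))) *
          (if vertexConserving L M k then (∏ i, c (k i).1) * ∏ i, hubbardPlaneWave L M β ((![(((0 : Fin 1), (0 : Fin 2)), (0 : Fin 2)), ((0, 0), 1), ((0, 1), 0), ((0, 1), 1)] : Fin 4 → SectorLeg 1) i).2 (k i) (x i) else 0) := by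
    intro k
    rw [klbv_kernel_vertexPattern, prod_mul_distrib]
    split_ifs <;> ring
  simp_rw [hterm]
  rw [← mul_sum]
  congr 1
  -- split the label sum into Matsubara labels and torus momenta
  rw [← Equiv.sum_comp (Equiv.arrowProdEquivProdArrow (Fin 4) (fun _ => MatsubaraIdx M) (fun _ => TorusSite 2 L)).symm, Fintype.sum_prod_type]
  have hsplit : ∀ (n : Fin 4 → MatsubaraIdx M) (b : Fin 4 → TorusSite 2 L),
      (if vertexConserving L M ((Equiv.arrowProdEquivProdArrow (Fin 4) (fun _ => MatsubaraIdx M) (fun _ => TorusSite 2 L)).symm (n, b)) then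
          (∏ i, c (((Equiv.arrowProdEquivProdArrow (Fin 4) (fun _ => MatsubaraIdx M) (fun _ => TorusSite 2 L)).symm (n, b)) i).1) * ∏ i, hubbardPlaneWave L M β ((![(((0 : Fin 1), (0 : Fin 2)), (0 : Fin 2)), ((0, 0), 1), ((0, 1), 0), ((0, 1), 1)] : Fin 4 → SectorLeg 1) i).2 (((Equiv.arrowProdEquivProdArrow (Fin 4) (fun _ => MatsubaraIdx M) (fun _ => TorusSite 2 L)).symm (n, b)) i) (x i)
        else 0) =
        (if matsubaraInt M (n 0) + matsubaraInt M (n 2) = matsubaraInt M (n 1) + matsubaraInt M (n 3) then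
            (∏ i : Fin 4, c (n i)) * ∏ i : Fin 4, Complex.exp (-((chargeSign ((![(((0 : Fin 1), (0 : Fin 2)), (0 : Fin 2)), ((0, 0), 1), ((0, 1), 0), ((0, 1), 1)] : Fin 4 → SectorLeg 1) i).2 * (matsubaraFreq β M (n i) * imagTime β M (x i).1) : ℝ) : ℂ) * Complex.I)
          else 0) *
        (if b 0 + b 2 = b 1 + b 3 then
            ∏ i : Fin 4, (if ((![(((0 : Fin 1), (0 : Fin 2)), (0 : Fin 2)), ((0, 0), 1), ((0, 1), 0), ((0, 1), 1)] : Fin 4 → SectorLeg 1) i).2 = 0 then conj (torusChar (b i) (x i).2) else torusChar (b i) (x i).2) else 0) := by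
    intro n b
    have he : ∀ i, ((Equiv.arrowProdEquivProdArrow (Fin 4) (fun _ => MatsubaraIdx M) (fun _ => TorusSite 2 L)).symm (n, b)) i = (n i, b i) := fun i => rfl
    simp only [vertexConserving, he]
    simp_rw [hubbardPlaneWave_eq, prod_mul_distrib]
    by_cases hT : matsubaraInt M (n 0) + matsubaraInt M (n 2) = matsubaraInt M (n 1) + matsubaraInt M (n 3)
    · by_cases hS : b 0 + b 2 = b 1 + b 3
      · rw [if_pos ⟨hT, hS⟩, if_pos hT, if_pos hS, mul_assoc]
      · rw [if_neg (fun h => hS h.2), if_pos hT, if_neg hS, mul_zero]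
    · rw [if_neg (fun h => hT h.1), if_neg hT, zero_mul]
  simp_rw [hsplit]
  rw [← sum_mul_sum]
  congr 1
  simp_rw [klbv_prod_spaceFactor]
  exact klbv_spaceSum_eq (fun i => (x i).2)

/-! ## §2 The pinned currency with a frequency multiplier -/

/-- **THE PLAIN PINNED CURRENCY OF THE BARE VERTEX READ WITH A FREQUENCY MULTIPLIER** (twin of `klbv_plainCurrency_hubbardInteraction_eq`, `c ≡ 1`):
`ε_x³ · Σ_{x′ : x′_q = y} ‖W₄^c(V)(x′)‖ = (|U|/24) · (2M)⁻³ · Σ_{t : t_q = y₀} |S^c_time(t)|` for every pinned leg `q`, point `y`, `0 < β`. -/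
theorem klbv_plainCurrency_hubbardInteraction_freqMul_eq [NeZero M] {β : ℝ} (hβ : 0 < β) (U : ℝ) (c : MatsubaraIdx M → ℂ) (q : Fin 4) (y : SpaceTimeIdx L M) :
    imagTimeWeight β M ^ 3 *
        ∑ x ∈ univ.filter (fun x : Fin 4 → SpaceTimeIdx L M => x q = y),
          ‖sectorisedKernel L M β (fun (_ : Fin 1) (k : FreqMomentum L M) => c k.1) (hubbardInteraction L M β U) 4 (![(((0 : Fin 1), (0 : Fin 2)), (0 : Fin 2)), ((0, 0), 1), ((0, 1), 0), ((0, 1), 1)] : Fin 4 → SectorLeg 1) x‖ =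
      |U| / 24 * ((((2 * M : ℕ) : ℝ) ^ 3)⁻¹ *
        ∑ t ∈ univ.filter (fun t : Fin 4 → ImagTimeIdx M => t q = y.1),
          ‖∑ n : Fin 4 → MatsubaraIdx M,
              if matsubaraInt M (n 0) + matsubaraInt M (n 2) = matsubaraInt M (n 1) + matsubaraInt M (n 3) then
                (∏ i : Fin 4, c (n i)) * ∏ i : Fin 4, Complex.exp (-((chargeSign ((![(((0 : Fin 1), (0 : Fin 2)), (0 : Fin 2)), ((0, 0), 1), ((0, 1), 0), ((0, 1), 1)] : Fin 4 → SectorLeg 1) i).2 * (matsubaraFreq β M (n i) * imagTime β M (t i)) : ℝ) : ℂ) * Complex.I)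
              else 0‖) := by
  have hL : (0 : ℝ) < L := by exact_mod_cast Nat.pos_of_ne_zero (NeZero.ne L)
  have hM : (0 : ℝ) < ((2 * M : ℕ) : ℝ) := by
    have := NeZero.ne M
    exact_mod_cast (by omega : 0 < 2 * M)
  -- the time sum as a function of the time labels
  set S : (Fin 4 → ImagTimeIdx M) → ℂ := fun t => ∑ n : Fin 4 → MatsubaraIdx M,
      if matsubaraInt M (n 0) + matsubaraInt M (n 2) = matsubaraInt M (n 1) + matsubaraInt M (n 3) then
        (∏ i : Fin 4, c (n i)) * ∏ i : Fin 4, Complex.exp (-((chargeSign ((![(((0 : Fin 1), (0 : Fin 2)), (0 : Fin 2)), ((0, 0), 1), ((0, 1), 0), ((0, 1), 1)] : Fin 4 → SectorLeg 1) i).2 * (matsubaraFreq β M (n i) * imagTime β M (t i)) : ℝ) : ℂ) * Complex.I)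
      else 0 with hSdef
  -- the constant
  have h24 : (((4 : ℕ).factorial : ℚ)⁻¹ • (1 : ℂ)) = ((24 : ℂ))⁻¹ := by
    rw [Rat.smul_one_eq_cast]; push_cast; norm_num [Nat.factorial]
  have hK : ‖((((U / (β * (L : ℝ) ^ 2) ^ 3 : ℝ)) : ℂ) * (((4 : ℕ).factorial : ℚ)⁻¹ • (1 : ℂ)))‖ = |U| / (β * (L : ℝ) ^ 2) ^ 3 / 24 := by
    rw [h24, norm_mul, Complex.norm_real, norm_inv, Real.norm_eq_abs, abs_div, abs_of_pos (by positivity : (0 : ℝ) < (β * (L : ℝ) ^ 2) ^ 3)]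
    norm_num [div_eq_mul_inv]
  -- pointwise norm of the kernel
  have hx : ∀ x : Fin 4 → SpaceTimeIdx L M,
      ‖sectorisedKernel L M β (fun (_ : Fin 1) (k : FreqMomentum L M) => c k.1) (hubbardInteraction L M β U) 4 (![(((0 : Fin 1), (0 : Fin 2)), (0 : Fin 2)), ((0, 0), 1), ((0, 1), 0), ((0, 1), 1)] : Fin 4 → SectorLeg 1) x‖ =
        (fun t : Fin 4 → ImagTimeIdx M => |U| / (β * (L : ℝ) ^ 2) ^ 3 / 24 * ‖S t‖) (fun i => (x i).1) *
          (if (x 0).2 = (x 3).2 ∧ (x 1).2 = (x 3).2 ∧ (x 2).2 = (x 3).2 then ((L : ℝ) ^ 6) else 0) := by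
    intro x
    rw [klbv_positionKernel_hubbardInteraction_freqMul_eq, norm_mul, hK, norm_mul, klbv_norm_coincidence (fun i => (x i).2)]
    simp only [hSdef]
    ring
  rw [klbv_pinned_split _ (fun t : Fin 4 → ImagTimeIdx M => |U| / (β * (L : ℝ) ^ 2) ^ 3 / 24 * ‖S t‖) ((L : ℝ) ^ 6) q y hx, ← mul_sum,
    imagTimeWeight]
  show _ = |U| / 24 * ((((2 * M : ℕ) : ℝ) ^ 3)⁻¹ * ∑ t ∈ univ.filter (fun t : Fin 4 → ImagTimeIdx M => t q = y.1), ‖S t‖)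
  have hβ0 : β ≠ 0 := hβ.ne'
  push_cast
  field_simp

/-! ## §3 The UV-CUT bare vertex (located #25, cure (α)): its plain position kernel is the `ĝ`-weighted read of `V` -/

/-- **The plain (`trivialMultiplier`) sectorised kernels of the UV-cut vertex `S_ĝ V` are the `ĝ`-weighted kernels of `V`** (`klbv_sectorisedKernel_map_mulLeft`,
`trivialMultiplier = 1`), `ĝ((k,σ),c) = gnScaleCutoff 4 klE0 1 |ω_k|`. -/
theorem klbv_sectorisedKernel_uvCut_hubbardInteraction_eq (β U : ℝ) (m : ℕ) (Ω : Fin m → SectorLeg 1) (x : Fin m → SpaceTimeIdx L M) :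
    sectorisedKernel L M β (trivialMultiplier L M)
        (ExteriorAlgebra.map (LinearMap.mulLeft ℂ (fun K : HubbardFieldIdx L M => ((gnScaleCutoff 4 klE0 1 |matsubaraFreq β M K.1.1.1| : ℝ) : ℂ))) (hubbardInteraction L M β U)) m Ω x =
      sectorisedKernel L M β (fun (_ : Fin 1) (k : FreqMomentum L M) => (((gnScaleCutoff 4 klE0 1 |matsubaraFreq β M k.1| : ℝ) : ℂ))) (hubbardInteraction L M β U) m Ω x := by
  rw [klbv_sectorisedKernel_map_mulLeft β (trivialMultiplier L M) (fun k : FreqMomentum L M => (((gnScaleCutoff 4 klE0 1 |matsubaraFreq β M k.1| : ℝ) : ℂ)))]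
  have hF : (fun (ω : Fin 1) (k : FreqMomentum L M) => trivialMultiplier L M ω k * (((gnScaleCutoff 4 klE0 1 |matsubaraFreq β M k.1| : ℝ) : ℂ))) =
      (fun (_ : Fin 1) (k : FreqMomentum L M) => (((gnScaleCutoff 4 klE0 1 |matsubaraFreq β M k.1| : ℝ) : ℂ))) := by
    funext ω k; simp [trivialMultiplier]
  rw [hF]

/-- **THE PLAIN PINNED CURRENCY OF THE UV-CUT BARE VERTEX** (the cure-(α) currency of binders #2/#5/#6 evaluated on `S_ĝ V`, `0 < β`):
`ε_x³ · Σ_{x′ : x′_q = y} ‖W₄(S_ĝ V)(x′)‖ = (|U|/24) · Θ^cut_M(β; q, y₀)`, `Θ^cut_M(β; q, y₀) = (2M)⁻³ · Σ_{t : t_q = y₀} |Σ_{n : n₀+n₂ = n₁+n₃ (in ℤ)} (∏_i ĝ(ω_{n_i})) ∏_i e^{−i s_i ω_{n_i} t_i}|`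
— the ALLOWED-quadruple trigonometric sum of located #25 with the four cut factors inserted.  [float] kit j340333/j340345: `Θ^cut ≈ 2.72` FLAT in `M` once `M ≳ β/16`
(vs the uncut `Θ_M ≍ (ln M)²` of `klbv_plainCurrency_hubbardInteraction_eq`).  Exact identity; no estimate. -/
theorem klbv_plainCurrency_uvCut_hubbardInteraction_eq [NeZero M] {β : ℝ} (hβ : 0 < β) (U : ℝ) (q : Fin 4) (y : SpaceTimeIdx L M) :
    imagTimeWeight β M ^ 3 *
        ∑ x ∈ univ.filter (fun x : Fin 4 → SpaceTimeIdx L M => x q = y),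
          ‖sectorisedKernel L M β (trivialMultiplier L M)
            (ExteriorAlgebra.map (LinearMap.mulLeft ℂ (fun K : HubbardFieldIdx L M => ((gnScaleCutoff 4 klE0 1 |matsubaraFreq β M K.1.1.1| : ℝ) : ℂ))) (hubbardInteraction L M β U)) 4
            (![(((0 : Fin 1), (0 : Fin 2)), (0 : Fin 2)), ((0, 0), 1), ((0, 1), 0), ((0, 1), 1)] : Fin 4 → SectorLeg 1) x‖ =
      |U| / 24 * ((((2 * M : ℕ) : ℝ) ^ 3)⁻¹ *
        ∑ t ∈ univ.filter (fun t : Fin 4 → ImagTimeIdx M => t q = y.1),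
          ‖∑ n : Fin 4 → MatsubaraIdx M,
              if matsubaraInt M (n 0) + matsubaraInt M (n 2) = matsubaraInt M (n 1) + matsubaraInt M (n 3) then
                (∏ i : Fin 4, (((gnScaleCutoff 4 klE0 1 |matsubaraFreq β M (n i)| : ℝ) : ℂ))) *
                  ∏ i : Fin 4, Complex.exp (-((chargeSign ((![(((0 : Fin 1), (0 : Fin 2)), (0 : Fin 2)), ((0, 0), 1), ((0, 1), 0), ((0, 1), 1)] : Fin 4 → SectorLeg 1) i).2 * (matsubaraFreq β M (n i) * imagTime β M (t i)) : ℝ) : ℂ) * Complex.I)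
              else 0‖) := by
  simp_rw [klbv_sectorisedKernel_uvCut_hubbardInteraction_eq]
  exact klbv_plainCurrency_hubbardInteraction_freqMul_eq hβ U (fun i : MatsubaraIdx M => (((gnScaleCutoff 4 klE0 1 |matsubaraFreq β M i| : ℝ) : ℂ))) q y

end Summit.HubbardSuperconductivity.HubbardSuperconductivity.Theorems.KLRegimeSplit

end
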